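import Summits.CriticalPhenomena.CardyFormulaZ2.Theorems.CardyFlipRussoCoveringLegWideBridge
import HarnessLib

/-!
# Vocabulary of line `five-arm-null`, skeleton v5 ("robust crude Cardy"), for the crux `CardyFlipRusso.CoveringLeg`
(stmt-CriticalPhenomena-6435)

Route `CardyFlipRusso` (sub-problem `CriticalPhenomena/CardyFormulaZ2`), crux
`Summit.CriticalPhenomena.CardyFormulaZ2.Theses.CardyFlipRusso.CoveringLeg`: Cardy's formula for critical SITE percolation
on the centred square lattice `G_s` (crude discretisation, frame A) IMPLIES Cardy's formula for critical BOND percolation on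
`ℤ²` (crude discretisation `embDomainCrossing squareLatticeEmbedding.z`).

Third **definitions module** of the line (after `CardyFlipRussoCoveringLegDefs.lean`, p115880, and
`CardyFlipRussoCoveringLegShiftDefs.lean`, p121158/p124215, whose objects `zS`, `gsGraph`, `lawP`, `crossS`, `SiteCardy`,
`CardyHalfShift`, … are reused verbatim).  Skeleton v5 (lead `prover-line-stmt-CriticalPhenomena-6435-c5-0`, cycle 6) proves
that the crux hypothesis is DISCRETISATION-ROBUST without any RSW input — Cardy for the crude frame-B `P_{1/2}` events of the
shifted family (`CardyHalfShift`, i.e. `SiteCardy` through the exact frame bridge) implies Cardy for the unshifted events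
(`CardySectorGap.CardyCentredSquare`, stmt-7048) and for the wide-slack Union-Jack events — by the Bollobás–Riordan collar
sandwich run with LOWER inclusions only, exact self-duality of site percolation on the triangulation `G_s` at `p = ½`, and
Radó continuity of the modulus; this discharges the site-side discretisation nulls `T`, `T'` of the twins file (p136569,
p136899) under `SiteCardy`, so that the crux follows EXACTLY from the existing item `UnionJackBeffara.MixedInterpolation`
(stmt-CriticalPhenomena-4559).

This file is sorry-free VOCABULARY: the wide-slack crude event `wideS` (the Union-Jack route's event read at mesh `√2·δ`,
`ujCrossingProb_eq_wideS`), the five stub STATEMENTS `Sig.stub_gsPlanar`, `Sig.stub_comparisonGeometryStrong`,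
`Sig.stub_lowerInclusion`, `Sig.stub_blocking`, `Sig.stub_flipBound` (`def … : Prop`, to be PROVED by helper files
`Theorems/CardyFlipRussoCoveringLeg<Stub>.lean --supports stmt-CriticalPhenomena-6435`; nothing is asserted here), and two
elementary remarks (`crossS_subset_wideS`, `isProbabilityMeasure_lawP`).

Sources: B. Bollobás, O. Riordan, *Percolation* (2006), Ch. 7 Lemma 14 p. 184, Claim 19 p. 192, remark p. 195
[BollobasRiordan2006]; V. Beffara, *Is critical 2D percolation universal?*, Progr. Probab. 60 (2008) §5.1–5.2
[Beffara2008Universal].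
-/

noncomputable section

namespace Summit.CriticalPhenomena.CardyFormulaZ2.Cruxes.CoveringLeg.FiveArmNull

open Filter Set Topology Metric MeasureTheory
open Literature.Probability.RandomPlanarGeometry Literature.Probability.Percolation
open Literature.Probability.LatticeModels
open Literature.Barriers.CriticalPhenomena (MixedSite mixedParam)
open Summit.CriticalPhenomena.CardyFormulaZ2.Theses

/-! ### The wide-slack (Union-Jack) crude event of frame B -/

/-- The frame-B crude crossing event of `R` at mesh `δ` with the WIDE endpoint slack `2√2·δ`: the Union-Jack route's event
read at mesh `√2·δ` (`ujCrossingProb_eq_wideS`). [cite: Beffara2008Universal, §5.1] -/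
def wideS (R : ConformalRectangle) (δ : ℝ) : Set (Set MixedSite) :=
  {ω | ∃ u v, infDist ((δ : ℂ) * zS u) (R.arc 0) ≤ 2 * Real.sqrt 2 * δ ∧
    infDist ((δ : ℂ) * zS v) (R.arc 2) ≤ 2 * Real.sqrt 2 * δ ∧
    ω ∈ siteConnIn gsGraph {y | (δ : ℂ) * zS y ∈ R.carrier} u v}

/-- The Union-Jack crude crossing probability at mesh `√2·δ` is the `lawP`-probability of `wideS R δ` (restating
`ujCrossingProb_sqrt_two_mul`, p136569). [cite: Beffara2008Universal, §5.1] -/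
theorem ujCrossingProb_eq_wideS (q : unitInterval) (R : ConformalRectangle) (δ : ℝ) :
    ujCrossingProb q R (Real.sqrt 2 * δ) = (lawP q).real (wideS R δ) :=
  ujCrossingProb_sqrt_two_mul q R δ

/-- The standard crude event is contained in the wide one (`2δ ≤ 2√2·δ`). [folklore] -/
theorem crossS_subset_wideS (R : ConformalRectangle) {δ : ℝ} (hδ : 0 ≤ δ) : crossS R δ ⊆ wideS R δ := by
  rintro ω ⟨u, v, hu, hv, hω⟩
  exact ⟨u, v, hu.trans (wide_two_mul_le_slack hδ), hv.trans (wide_two_mul_le_slack hδ), hω⟩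

/-- Beffara's mixed law is a probability measure (a product Bernoulli measure). [cite: Beffara2008Universal, §5.1] -/
theorem isProbabilityMeasure_lawP : ∀ q : unitInterval, MeasureTheory.IsProbabilityMeasure (Summit.CriticalPhenomena.CardyFormulaZ2.Cruxes.CoveringLeg.FiveArmNull.lawP q) :=
  fun _ => instIsProbabilityMeasureProdBernoulli _

/-! ### The five stub statements of skeleton v5 (`Sig.stub_X` is the statement of the registered `stub_X`)

Nothing is asserted here. -/

/-- STUB — **the straight-line drawing `zS` of `G_s` is planar**: `zS` is injective, no vertex lies on a non-incident closed
edge segment, and vertex-disjoint edges have disjoint closed segments.  (In the coordinates `√2·zS` the type-I sites are the odd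
points and the face centres the even points of `ℤ²`; the edges are the four axis steps at every point and, at odd points only,
the four diagonal steps — one diagonal per unit square, so the drawing is a triangulation.)  Registered stub STATEMENT (nothing
asserted). -/
def Sig.stub_gsPlanar : Prop :=
  Function.Injective zS ∧
    (∀ u v w : MixedSite, gsGraph.Adj u v → w ≠ u → w ≠ v → zS w ∉ segment ℝ (zS u) (zS v)) ∧
    (∀ u v u' v' : MixedSite, gsGraph.Adj u v → gsGraph.Adj u' v' → u ≠ u' → u ≠ v' → v ≠ u' → v ≠ v' →
      Disjoint (segment ℝ (zS u) (zS v)) (segment ℝ (zS u') (zS v')))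

/-- STUB — **comparison quads in sandwich position, with the all-points margin clause.**  For a conformal rectangle `R` and
a closeness budget `ε₀ > 0` there is a margin `m > 0` such that for every plate margin `t > 0` there are: a LOWER quad `Q`
(boundary loop and marks `ε₀`-close to those of `R`; with a room `r > 0`: points of the `r`-fattening of `Q` off `Ω` are
`t`-close to `arc 0 ∪ arc 2`, ALL points of it are `m`-far from `arc 1 ∪ arc 3`, and the `r`-fattened end arcs `Q.arc 0`,
`Q.arc 2` lie off `Ω`, `t`-close to `arc 0`, `arc 2`), and an UPPER quad `N` (the same for the cyclically re-marked rectangle: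
boundary close to `u ↦ R.boundary (u + R.mark 1)`, marks close to `(0, m₂ − m₁, m₃ − m₁, m₀ + 1 − m₁)`, allowed arcs
`1, 3`, banned arcs `0, 2`).  This is the tree's `stub_comparisonGeometry` (line oracle-sandwich of crux `LoopsToCrossings`)
with clause 4 strengthened from "points IN `Ω`" to "ALL points" of the fattened quad.  Registered stub STATEMENT (nothing
asserted). -/
def Sig.stub_comparisonGeometryStrong : Prop :=
  ∀ (R : ConformalRectangle) (ε₀ : ℝ), 0 < ε₀ → ∃ m : ℝ, 0 < m ∧ ∀ t : ℝ, 0 < t →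
      (∃ (Q : ConformalRectangle) (r : ℝ), 0 < r ∧
          (∀ u : ℝ, dist (Q.boundary u) (R.boundary u) ≤ ε₀) ∧
          (∀ i : Fin 4, |Q.mark i - R.mark i| ≤ ε₀) ∧
          (∀ z ∈ cthickening r Q.carrier, z ∉ R.carrier → infDist z (R.arc 0) ≤ t ∨ infDist z (R.arc 2) ≤ t) ∧
          (∀ z ∈ cthickening r Q.carrier, m ≤ infDist z (R.arc 1) ∧ m ≤ infDist z (R.arc 3)) ∧
          (∀ z ∈ cthickening r (Q.arc 0), z ∉ R.carrier ∧ infDist z (R.arc 0) ≤ t) ∧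
          (∀ z ∈ cthickening r (Q.arc 2), z ∉ R.carrier ∧ infDist z (R.arc 2) ≤ t)) ∧
      (∃ (N : ConformalRectangle) (r : ℝ), 0 < r ∧
          (∀ u : ℝ, dist (N.boundary u) (R.boundary (u + R.mark 1)) ≤ ε₀) ∧
          (∀ i : Fin 4, |N.mark i - ![0, R.mark 2 - R.mark 1, R.mark 3 - R.mark 1, R.mark 0 + 1 - R.mark 1] i| ≤ ε₀) ∧
          (∀ z ∈ cthickening r N.carrier, z ∉ R.carrier → infDist z (R.arc 1) ≤ t ∨ infDist z (R.arc 3) ≤ t) ∧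
          (∀ z ∈ cthickening r N.carrier, m ≤ infDist z (R.arc 0) ∧ m ≤ infDist z (R.arc 2)) ∧
          (∀ z ∈ cthickening r (N.arc 0), z ∉ R.carrier ∧ infDist z (R.arc 1) ≤ t) ∧
          (∀ z ∈ cthickening r (N.arc 2), z ∉ R.carrier ∧ infDist z (R.arc 3) ≤ t))

/-- STUB — **lower inclusion** (the corner-free half of Bollobás–Riordan's Claim 19, for the CRUDE event): if the lower quad
`Q` of `R` is in sandwich position with margins `m, t` and room `r`, the arcs `0`, `2` of `R` are `3t`-separated, and
`0 < δ`, `3δ ≤ r`, `δ < m`, `δ ≤ t`, then for every translation `a` with `‖a‖ ≤ δ` the crude frame-B crossing event of `Q + a` at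
mesh `δ` is contained in that of `R` (an open `G_s`-path with sites in `Q + a` from `2δ`-near `Q.arc 0 + a` to `2δ`-near
`Q.arc 2 + a` starts and ends outside `Ω`; after its last visit to the `arc 0` side it enters `Ω` across `arc 0`, the entering
site being within one mesh edge `≤ δ` of `arc 0`, and it first leaves `Ω` across `arc 2`).  Registered stub STATEMENT (nothing
asserted). -/
def Sig.stub_lowerInclusion : Prop :=
  ∀ (R Q : ConformalRectangle) (m t r : ℝ), 0 < m → 0 < t → 0 < r →
      (∀ z ∈ cthickening r Q.carrier, z ∉ R.carrier → infDist z (R.arc 0) ≤ t ∨ infDist z (R.arc 2) ≤ t) →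
      (∀ z ∈ cthickening r Q.carrier, z ∈ R.carrier → m ≤ infDist z (R.arc 1) ∧ m ≤ infDist z (R.arc 3)) →
      (∀ z ∈ cthickening r (Q.arc 0), z ∉ R.carrier ∧ infDist z (R.arc 0) ≤ t) →
      (∀ z ∈ cthickening r (Q.arc 2), z ∉ R.carrier ∧ infDist z (R.arc 2) ≤ t) →
      (∀ x ∈ R.arc 0, ∀ y ∈ R.arc 2, 3 * t < dist x y) →
      ∀ δ : ℝ, 0 < δ → 3 * δ ≤ r → δ < m → δ ≤ t → ∀ a : ℂ, ‖a‖ ≤ δ →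
        crossS (Q.map (similarity 1 one_ne_zero a)) δ ⊆ crossS R δ

/-- STUB — **blocking** (the exact duality half): for every conformal rectangle `R` and margin `m > 0` there is a plate margin
`t > 0` such that for every upper quad `N` of `R` in sandwich position (fattened `N` off `Ω` is `t`-close to `arc 1 ∪ arc 3`, ALL
of fattened `N` is `m`-far from `arc 0 ∪ arc 2`, the fattened end arcs of `N` lie off `Ω`), for all small `δ` and every
translation `‖a‖ ≤ δ`: a configuration whose COMPLEMENT has a crude frame-B crossing of `N + a` (a closed `G_s`-path) has no
open wide-slack crude crossing of `R` (the two polygonal traces are disjoint by planarity of the drawing and open ≠ closed;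
pulled back by a square model of `R` they cross a rectangle in transverse directions, hence meet).  Registered stub STATEMENT
(nothing asserted; the registered stub is `stub_blocking_of_planar : Sig.stub_gsPlanar → Sig.stub_blocking`). -/
def Sig.stub_blocking : Prop :=
  ∀ (R : ConformalRectangle) (m : ℝ), 0 < m → ∃ t : ℝ, 0 < t ∧
      ∀ (N : ConformalRectangle) (r : ℝ), 0 < r →
        (∀ z ∈ cthickening r N.carrier, z ∉ R.carrier → infDist z (R.arc 1) ≤ t ∨ infDist z (R.arc 3) ≤ t) →
        (∀ z ∈ cthickening r N.carrier, m ≤ infDist z (R.arc 0) ∧ m ≤ infDist z (R.arc 2)) →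
        (∀ z ∈ cthickening r (N.arc 0), z ∉ R.carrier ∧ infDist z (R.arc 1) ≤ t) →
        (∀ z ∈ cthickening r (N.arc 2), z ∉ R.carrier ∧ infDist z (R.arc 3) ≤ t) →
        ∃ δ₀ : ℝ, 0 < δ₀ ∧ ∀ δ : ℝ, 0 < δ → δ ≤ δ₀ → ∀ a : ℂ, ‖a‖ ≤ δ →
          ∀ ω : Set MixedSite, ωᶜ ∈ crossS (N.map (similarity 1 one_ne_zero a)) δ → ω ∉ wideS R δ

/-- STUB — **flip invariance and the complement bound**: at `q = ½` the law `lawP half = sitePercolation _ half` is invariant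
under `ω ↦ ωᶜ` and the crude event is measurable, so an event missed by every configuration whose complement crosses `N + a`
has probability at most `1 − P_{1/2}[cross (N + a)]`.  Registered stub STATEMENT (nothing asserted). -/
def Sig.stub_flipBound : Prop :=
  ∀ (N : ConformalRectangle) (δ : ℝ), 0 < δ → ∀ (a : ℂ) (E : Set (Set MixedSite)),
      (∀ ω : Set MixedSite, ωᶜ ∈ crossS (N.map (similarity 1 one_ne_zero a)) δ → ω ∉ E) →
      (lawP half).real E ≤ 1 - (lawP half).real (crossS (N.map (similarity 1 one_ne_zero a)) δ)

/-! ### Certificates (`Iff.rfl`) — the expanded texts of two stubs whose statements mention `wideS` / `zS` -/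

/-- `Sig.stub_gsPlanar` unfolded. [cite: Beffara2008Universal, §5.1] -/
theorem stub_gsPlanar_iff :
    Sig.stub_gsPlanar ↔
      Function.Injective zS ∧
        (∀ u v w : MixedSite, gsGraph.Adj u v → w ≠ u → w ≠ v → zS w ∉ segment ℝ (zS u) (zS v)) ∧
        (∀ u v u' v' : MixedSite, gsGraph.Adj u v → gsGraph.Adj u' v' → u ≠ u' → u ≠ v' → v ≠ u' → v ≠ v' →
          Disjoint (segment ℝ (zS u) (zS v)) (segment ℝ (zS u') (zS v'))) :=
  Iff.rfl

/-- `Sig.stub_blocking` unfolded down to the inline wide event. [cite: BollobasRiordan2006, Ch. 7 Claim 19 p. 192] -/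
theorem stub_blocking_iff :
    Sig.stub_blocking ↔
      ∀ (R : ConformalRectangle) (m : ℝ), 0 < m → ∃ t : ℝ, 0 < t ∧
        ∀ (N : ConformalRectangle) (r : ℝ), 0 < r →
          (∀ z ∈ cthickening r N.carrier, z ∉ R.carrier → infDist z (R.arc 1) ≤ t ∨ infDist z (R.arc 3) ≤ t) →
          (∀ z ∈ cthickening r N.carrier, m ≤ infDist z (R.arc 0) ∧ m ≤ infDist z (R.arc 2)) →
          (∀ z ∈ cthickening r (N.arc 0), z ∉ R.carrier ∧ infDist z (R.arc 1) ≤ t) →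
          (∀ z ∈ cthickening r (N.arc 2), z ∉ R.carrier ∧ infDist z (R.arc 3) ≤ t) →
          ∃ δ₀ : ℝ, 0 < δ₀ ∧ ∀ δ : ℝ, 0 < δ → δ ≤ δ₀ → ∀ a : ℂ, ‖a‖ ≤ δ →
            ∀ ω : Set MixedSite, ωᶜ ∈ crossS (N.map (similarity 1 one_ne_zero a)) δ →
              ω ∉ {ω : Set MixedSite | ∃ u v, infDist ((δ : ℂ) * zS u) (R.arc 0) ≤ 2 * Real.sqrt 2 * δ ∧
                infDist ((δ : ℂ) * zS v) (R.arc 2) ≤ 2 * Real.sqrt 2 * δ ∧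
                ω ∈ siteConnIn gsGraph {y | (δ : ℂ) * zS y ∈ R.carrier} u v} :=
  Iff.rfl

/-- The lower-inclusion stub only needs the WEAK (in-`Ω`) form of the margin clause, which the strong quads provide.
[folklore] -/
theorem margin_weak_of_strong {R Q : ConformalRectangle} {m r : ℝ}
    (h : ∀ z ∈ cthickening r Q.carrier, m ≤ infDist z (R.arc 1) ∧ m ≤ infDist z (R.arc 3)) :
    ∀ z ∈ cthickening r Q.carrier, z ∈ R.carrier → m ≤ infDist z (R.arc 1) ∧ m ≤ infDist z (R.arc 3) :=
  fun z hz _ => h z hz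

/-! ### Skeleton v5, registration form of the blocking stub (append, lead c5) -/

/-- STUB — **blocking from planarity**, as ONE named statement (`Sig.stub_gsPlanar → Sig.stub_blocking`): the registered
stub of skeleton v5 is `stub_blocking_of_planar : Sig.stub_blockingOfPlanar`, so that the composition `CoveringLeg_of`
consumes the planarity stub and the blocking stub by name.  Registered stub STATEMENT (nothing asserted). -/
def Sig.stub_blockingOfPlanar : Prop :=
  Sig.stub_gsPlanar → Sig.stub_blocking

/-- `Sig.stub_blockingOfPlanar` unfolded. [cite: BollobasRiordan2006, Ch. 7 Claim 19 p. 192] -/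
theorem stub_blockingOfPlanar_iff : Sig.stub_blockingOfPlanar ↔ (Sig.stub_gsPlanar → Sig.stub_blocking) :=
  Iff.rfl

end Summit.CriticalPhenomena.CardyFormulaZ2.Cruxes.CoveringLeg.FiveArmNull

end
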